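import Summits.NavierStokesRegularity.NavierStokesRegularity.Theorems.ScenarioCensusLargeOrderRigidity
import Summits.NavierStokesRegularity.NavierStokesRegularity.Theorems.AxisymmetricExtremalityAxisymmetricKatoGlobalNoSwirlStratum
import Literature.Analysis.FluidPDE.LocalLerayWeakStrongViscosity
import Literature.Analysis.FluidPDE.RusinSverakLerayAeEqKatoHolds
import Literature.Analysis.FluidPDE.KatoLocalLerayPressure
import Literature.Analysis.FluidPDE.RusinSverakSingularPoint
import Literature.Analysis.FluidPDE.RusinSverakSingularPointProofs
import Literature.Analysis.FluidPDE.KatoFarFieldBound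
import Literature.Analysis.FluidPDE.KatoLocalHolds
import Literature.Analysis.FluidPDE.KNSSAxisymmetricNoSwirl
import Literature.Analysis.FluidPDE.BoundedRepresentative
import Literature.Analysis.FluidPDE.KatoLocalL3Exists
import Literature.Analysis.FluidPDE.SolenoidalL2Duality
import Literature.Analysis.FluidPDE.HomSobolevWeakLimits
import Literature.Analysis.FluidPDE.GavrilovLocalisation
import Literature.Analysis.FluidPDE.SereginZajaczkowski2007SwirlRotation
import HarnessLib.Audit

/-!
# Scenario census, sub-row F13dL of row F13mL (`ScenarioCensus.Row_F13mLarge`): the DIHEDRAL large-order cell at bounded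
# critical budget is a THEOREM — part 1/3: the cell `Row_F13dLargeL3`, the residual S3 `NoSwirlL3LerayRegular` (PROVED),
# the theorem of the line `row_F13dLargeL3_holds`

Port (typer seat ns-census-typer-1 g6; lead g8 GO 2026-08-28T18:02Z, split «file 2 + keys» agreed with typer-2 g8 18:04Z) of
the ideator's tree-ready kit file 2 `pub/ideators/ns-idea-9/lines/dihedral_noswirl/landing/ScenarioCensusRowF13dLargeL3.lean`
(ns-idea-9 g6, LINE 14 «dihedral_noswirl» REV 8 bef4d09e9c956928; kit file sha16 c3e138e50225bf3d, 925 l.; ref g7 PRE-CHECK ✓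
§12.34 / §12.41, critic idea-crit-8 V56/V57/V58 PASS), on top of typer-2 g8's port of kit file 1
(`Theorems/ScenarioCensusLargeOrderRigidity.lean` and its parts, namespace `…ScenarioCensus.LargeOrderRigidity`).  Split for the
400-line rule into THREE modules: `ScenarioCensusRowF13dLargeL3Cell` (part 1) ← `ScenarioCensusRowF13dLargeL3Minimal` (part 2,
a leaf: the only part importing a module in the cone of route file `Theses/AxisymmetricExtremality.lean`) and part 1 ←
`ScenarioCensusRowF13dLargeL3` (part 3, the kit's name; it also carries the census keys in namespace `…ScenarioCensus`, which
therefore stay outside that cone).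
Declarations VERBATIM in the kit's namespace `…Theorems.ScenarioCensus.RowF13dLargeL3`; the only edits: the kit's
`local notation "ℝ³"` is spelled with the tree abbreviation `LargeOrderRigidity.R3` (typer lint: no notation), and one-line
docstrings are added to two undocumented auxiliaries (`avgSeq_comp`, `measurableSet_parabolicCylinder`), and — to keep parts 1 and 3
(hence the census keys) OUT of the cone of route file `Theses/AxisymmetricExtremality.lean` — the single use of
`PFoldToAxisymmetric.AeAxisymmetricUpgrade.hasGlobalKatoSolution_congr_ae` in `hasGlobalKatoSolution_of_aeDihedral` (part 1) is served by
the route-independent tree lemma `HasGlobalKatoSolution.congr_datum_ae` (same statement up to `symm`; that module's Literature imports are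
imported directly); every statement is unchanged.

This part: `Row_F13dLargeL3` := for every `ν > 0` and `K` there is `m₀` such that for `m ≥ m₀` row F13m's frame VERBATIM
(classical Leray–Hopf solution on `[0, T)` from a rapidly decaying datum, `m`-fold equivariant about the `x₃`-axis) PLUS
the mirror clause `u 0 (reflY x) = reflY (u 0 x)` PLUS the critical budget `‖u 0‖_{L³} ≤ K ν` gives
`HasSmoothExtensionPast`; glue `row_F13dLargeL3_of_row_F13mLarge : Row_F13mLarge → Row_F13dLargeL3`;
`mirror_iff_hasNoSwirl`; S3 = `noSwirlL3LerayRegular_holds` (Lebesgue-point symmetrisation `symRep` + the TREE theorem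
`AxisymmetricKatoGlobal.NoSwirlStratum.hasGlobalKatoSolution_of_isAxisymmetric_hasNoSwirl_viscosity` + translation
covariance + weak–strong uniqueness `leray_solution_ae_eq_kato_of_viscosity leray_solution_ae_eq_kato_holds` + Kato
smoothing `kato_solution_le_div_sqrt_of_kato_local_L3 kato_local_L3_holds`); the line's theorem
`row_F13dLargeL3_of : NoSwirlL3LerayRegular → Row_F13dLargeL3` (S1ᴰ `LargeOrderRigidity.normalisedBadSequenceD` → tree
`leray_solution_L3_weak_stability_holds` → S2ᴰ `LargeOrderRigidity.profileRigidityD` → S3) and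
`row_F13dLargeL3_holds : Row_F13dLargeL3`.  Corollaries D/K (part 2) and O/O′/K′ + census keys (part 3) follow.

**NOT THE ROW:** the census row `Row_F13mLarge` (neither mirror nor budget), `Row_F0`, `Row_F5` are untouched and stay
OPEN; NS regularity is NOT proved; no summit statement is proved in this file.
-/

noncomputable section

set_option linter.dupNamespace false
set_option linter.unusedVariables false

open Set Function Filter Topology MeasureTheory Metric TopologicalSpace
open scoped NNReal ENNReal RealInnerProductSpace

namespace Summit.NavierStokesRegularity.NavierStokesRegularity.Theorems.ScenarioCensus.RowF13dLargeL3

open Literature.Analysis Literature.Analysis.FluidPDE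
open Summit.NavierStokesRegularity.NavierStokesRegularity.Theorems.ScenarioCensus
open Summit.NavierStokesRegularity.NavierStokesRegularity.Theorems.ScenarioCensus.LargeOrderRigidity
open Summit.NavierStokesRegularity.NavierStokesRegularity.Theorems.AxisymmetricKatoGlobal.NoSwirlStratum

/-! ## The cell and its residual (the residual is PROVED below) -/

/-- **The cell of LINE 14** (dihedral budgeted large-order cell): for every `ν > 0` and budget `K` there
is an order `m₀` such that, for `m ≥ m₀`, Row F13m's frame VERBATIM plus the mirror clause
`u 0 (σ x) = σ (u 0 x)` plus `‖u 0‖_{L³} ≤ K ν` gives extension past `T`.  PROVED by this line (rev 4: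
`row_F13dLargeL3_holds`, no `sorry`); nothing asserted by the definition itself. -/
def Row_F13dLargeL3 : Prop :=
  ∀ (ν K : ℝ), 0 < ν → ∃ m₀ : ℕ, ∀ m : ℕ, m₀ ≤ m →
    ∀ (T : ℝ), 0 < T →
    ∀ (u : ℝ → R3 → R3) (p : ℝ → R3 → ℝ),
      IsClassicalNSSolutionOn (Ico 0 T) ν 0 u p → IsLerayHopfOn T ν 0 (u 0) u →
      HasRapidSpatialDecay (u 0) →
      (∀ x : R3, u 0 (rotZ (2 * Real.pi / m) x) = rotZ (2 * Real.pi / m) (u 0 x)) →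
      (∀ x : R3, u 0 (reflY x) = reflY (u 0 x)) →
      eLpNorm (u 0) 3 volume ≤ ENNReal.ofReal (K * ν) →
        HasSmoothExtensionPast ν 0 u T

/-- **Residual of LINE 14 (PROVED in this file, rev 4: `noSwirlL3LerayRegular_holds`):** swirl-free axisymmetric regularity in
the `L³` class, local-Leray form — for `ν > 0`, a weakly divergence-free `a ∈ L³(ℝ³)` which is
a.e.-axisymmetric about some vertical axis and a.e.-mirror-symmetric in a vertical plane through it (= no
swirl), and any local Leray solution `(U, P)` with datum `a`, every point `(t₀, x₀)`, `t₀ > 0`, has a backward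
cylinder on which `U` is essentially bounded.
«WLOG vertical axis / horizontal `ξ`»: the row and the cell fix the symmetry axis as THE `z`-axis (`rotZ`,
`reflY`), and the blow-up normalisation `x ↦ λ (x − x_*)` of S1ᴰ moves it to a vertical line, which we
label by its horizontal trace `ξ` (`ξ 2 = 0`); so only vertical axes occur downstream and the residual is
stated for them. The statement for an arbitrary axis (direction `e`, point `ξ`) is equivalent by a rigid
motion of coordinates (NS is Euclidean-covariant) and is not needed here. -/
def NoSwirlL3LerayRegular : Prop :=
  ∀ (ν : ℝ), 0 < ν → ∀ (ξ : R3) (a : R3 → R3) (U : ℝ → R3 → R3) (P : ℝ → R3 → ℝ),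
    ξ 2 = 0 → MemLp a 3 volume → IsWeaklyDivFree a → IsAEAxisymmetricAbout ξ a →
    IsAEMirrorSymmetricAbout ξ a → IsLocalLeraySolution ν a U P →
    ∀ (t₀ : ℝ) (x₀ : R3), 0 < t₀ → ∃ r : ℝ, 0 < r ∧
      eLpNorm (uncurry U) ∞ (volume.restrict (parabolicCylinder r ((t₀ : ℝ), x₀))) < ∞

/-! ## Kernel glue to the census row, and the meaning of the mirror clause -/

/-- **Row F13mLarge ⇒ the cell** (mirror and budget hypotheses are dropped). -/
theorem row_F13dLargeL3_of_row_F13mLarge (h : Row_F13mLarge) : Row_F13dLargeL3 := by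
  obtain ⟨m₀, hm₀⟩ := h
  intro ν K hν
  exact ⟨m₀, fun m hm T hT u p hcl hLH hdec hsym _ _ => hm₀ m hm ν T hν hT u p hcl hLH hdec hsym⟩

/-- **For an axisymmetric datum the mirror clause is exactly «no swirl»** (tree, PROVED:
`IsAxisymmetric.hasNoSwirl_iff_reflY`, Majda–Bertozzi 2002 §2.3.3).  So on axisymmetric data the cell is
swirl-free axisymmetric regularity (KNOWN), and on `C_m` data the two clauses say: `D_m`-symmetric. -/
theorem mirror_iff_hasNoSwirl {u₀ : R3 → R3} (hu : IsAxisymmetric u₀) :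
    (∀ x : R3, u₀ (reflY x) = reflY (u₀ x)) ↔ HasNoSwirl u₀ :=
  hu.hasNoSwirl_iff_reflY.symm

/-! ## S3 — swirl-free axisymmetric regularity in the `L³` class (rev 4: PROVED from the tree) -/

/-! ### S3, step 1 — symmetrisation: an a.e.-equivariant `L¹_loc` field has an EVERYWHERE-equivariant representative
(ball averages are exactly equivariant; Lebesgue differentiation) -/

section Sym

variable {b : R3 → R3}

/-- Ball average of `b` at scale `r`. -/
def ballAvg (b : R3 → R3) (r : ℝ) (x : R3) : R3 := ⨍ y in closedBall x r, b y

/-- Ball averages are EXACTLY equivariant under a linear isometry for which `b` is a.e.-equivariant. -/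
theorem ballAvg_comp (L : R3 ≃ₗᵢ[ℝ] R3) (hL : (fun x => b (L x)) =ᵐ[volume] fun x => L (b x))
    (r : ℝ) (x : R3) : ballAvg b r (L x) = L (ballAvg b r x) := by
  unfold ballAvg
  have hpre : (L : R3 → R3) ⁻¹' closedBall (L x) r = closedBall x r := by
    ext y
    simp [mem_closedBall, dist_eq_norm]
  have h1 : ∫ y in closedBall (L x) r, b y = ∫ y in closedBall x r, b (L y) := by
    rw [← hpre]
    exact (L.measurePreserving.setIntegral_preimage_emb L.toHomeomorph.measurableEmbedding b _).symm
  have h2 : ∫ y in closedBall x r, b (L y) = ∫ y in closedBall x r, L (b y) :=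
    integral_congr_ae (ae_restrict_of_ae hL)
  have h3 : ∫ y in closedBall x r, L (b y) = L (∫ y in closedBall x r, b y) := by
    have := (L.toContinuousLinearEquiv).integral_comp_comm (μ := volume.restrict (closedBall x r)) b
    simpa using this
  have hvol : volume (closedBall (L x) r) = volume (closedBall x r) := by
    rw [Measure.addHaar_closedBall_center volume (L x), Measure.addHaar_closedBall_center volume x]
  rw [setAverage_eq, setAverage_eq, h1, h2, h3, Measure.real, Measure.real, hvol, map_smul]

/-- The averaging sequence at `x`. -/
def avgSeq (b : R3 → R3) (x : R3) (n : ℕ) : R3 := ballAvg b (1 / ((n : ℝ) + 1)) x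

open Classical in
/-- The symmetric representative: the limit of ball averages where it exists, `0` elsewhere. -/
def symRep (b : R3 → R3) (x : R3) : R3 :=
  if h : ∃ v, Tendsto (avgSeq b x) atTop (𝓝 v) then h.choose else 0

/-- The averaging sequence is exactly `L`-equivariant (from `ballAvg_comp`). -/
theorem avgSeq_comp (L : R3 ≃ₗᵢ[ℝ] R3) (hL : (fun x => b (L x)) =ᵐ[volume] fun x => L (b x))
    (x : R3) : avgSeq b (L x) = fun n => L (avgSeq b x n) :=
  funext fun n => ballAvg_comp L hL _ x

/-- `symRep b` is exactly `L`-equivariant. -/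
theorem symRep_comp (L : R3 ≃ₗᵢ[ℝ] R3) (hL : (fun x => b (L x)) =ᵐ[volume] fun x => L (b x))
    (x : R3) : symRep b (L x) = L (symRep b x) := by
  have hseq := avgSeq_comp L hL x
  unfold symRep
  by_cases h : ∃ v, Tendsto (avgSeq b x) atTop (𝓝 v)
  · have hx : Tendsto (avgSeq b (L x)) atTop (𝓝 (L h.choose)) := by
      rw [hseq]; exact (L.continuous.tendsto _).comp h.choose_spec
    have h' : ∃ v, Tendsto (avgSeq b (L x)) atTop (𝓝 v) := ⟨_, hx⟩
    rw [dif_pos h', dif_pos h]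
    exact tendsto_nhds_unique h'.choose_spec hx
  · have h' : ¬ ∃ v, Tendsto (avgSeq b (L x)) atTop (𝓝 v) := by
      rintro ⟨v, hv⟩
      refine h ⟨L.symm v, ?_⟩
      have := (L.symm.continuous.tendsto _).comp hv
      rw [hseq] at this
      simpa [Function.comp_def] using this
    rw [dif_neg h', dif_neg h, map_zero]

/-- `symRep b = b` a.e. (Lebesgue differentiation). -/
theorem symRep_ae_eq (hb : LocallyIntegrable b volume) : symRep b =ᵐ[volume] b := by
  have hδ : Tendsto (fun n : ℕ => 1 / ((n : ℝ) + 1)) atTop (𝓝[>] 0) :=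
    tendsto_nhdsWithin_iff.2 ⟨tendsto_one_div_add_atTop_nhds_zero_nat,
      Eventually.of_forall fun n => by simp only [mem_Ioi]; positivity⟩
  filter_upwards [IsUnifLocDoublingMeasure.ae_tendsto_average volume hb 1] with x hx
  have hlim : Tendsto (avgSeq b x) atTop (𝓝 (b x)) := by
    have := hx (fun _ : ℕ => x) (fun n : ℕ => 1 / ((n : ℝ) + 1)) hδ
      (Eventually.of_forall fun _ => mem_closedBall_self (by positivity))
    show Tendsto (fun n : ℕ => ballAvg b (1 / ((n : ℝ) + 1)) x) atTop (𝓝 (b x))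
    simpa [ballAvg, one_div] using this
  have h : ∃ v, Tendsto (avgSeq b x) atTop (𝓝 v) := ⟨b x, hlim⟩
  simp only [symRep, dif_pos h]
  exact tendsto_nhds_unique h.choose_spec hlim

end Sym

/-! ### S3, step 2 — the tree's swirl-free global Kato theorem + weak–strong uniqueness + Kato smoothing -/

/-- Parabolic cylinders are measurable. -/
theorem measurableSet_parabolicCylinder (r : ℝ) (z : ℝ × R3) :
    MeasurableSet (parabolicCylinder r z) :=
  measurableSet_Ioo.prod measurableSet_ball

/-- **a.e.-dihedral `L³` data are globally Kato-regular** (rev 5; the heart of S3, factored out so that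
Corollary D can reuse it).  If `a ∈ L³` is weakly divergence-free, a.e.-axisymmetric and a.e.-mirror-symmetric
about the vertical axis through `ξ`, then `a` has a GLOBAL Kato solution at every viscosity `ν > 0`: symmetrise
the translate `a (ξ + ·)` (`symRep`: exactly axisymmetric and mirror-symmetric, hence swirl-free by the tree's
`IsAxisymmetric.hasNoSwirl_iff_reflY`), apply the TREE THEOREM
`AxisymmetricKatoGlobal.NoSwirlStratum.hasGlobalKatoSolution_of_isAxisymmetric_hasNoSwirl_viscosity`, translate
back (`HasGlobalKatoSolution.translate`, tree) and change the datum on a null set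
(`PFoldToAxisymmetric.AeAxisymmetricUpgrade.hasGlobalKatoSolution_congr_ae`, tree). -/
theorem hasGlobalKatoSolution_of_aeDihedral {ν : ℝ} (hν : 0 < ν) {ξ : R3} {a : R3 → R3}
    (ha : MemLp a 3 volume) (hdiv : IsWeaklyDivFree a)
    (hax : IsAEAxisymmetricAbout ξ a) (hmir : IsAEMirrorSymmetricAbout ξ a) :
    HasGlobalKatoSolution ν a := by
  -- translate the axis to the `z`-axis
  set b : R3 → R3 := fun x => a (ξ + x) with hb
  have hb3 : MemLp b 3 volume := by
    have := ha.comp_measurePreserving (measurePreserving_add_left volume ξ)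
    simpa [Function.comp_def, hb] using this
  have hbdiv : IsWeaklyDivFree b := by
    have := hdiv.comp_sub_right (-ξ)
    convert this using 2 with x
    simp [hb, sub_neg_eq_add, add_comm]
  -- symmetrise
  have hbt_ae : symRep b =ᵐ[volume] b := symRep_ae_eq (hb3.locallyIntegrable (by norm_num))
  have hrot : IsAxisymmetric (symRep b) := by
    intro θ x
    have hL : (fun x => b (rotZLIE θ x)) =ᵐ[volume] fun x => rotZLIE θ (b x) := by
      simpa [rotZLIE_apply, hb] using hax θ
    simpa [rotZLIE_apply] using symRep_comp (rotZLIE θ) hL x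
  have hmirror : ∀ x, symRep b (reflY x) = reflY (symRep b x) := fun x =>
    symRep_comp (b := b) reflY (by simpa only [IsAEMirrorSymmetricAbout, hb] using hmir) x
  have hsw : HasNoSwirl (symRep b) := hrot.hasNoSwirl_iff_reflY.2 hmirror
  have hbt3 : MemLp (symRep b) 3 volume := hb3.ae_eq hbt_ae.symm
  have hbtdiv : IsWeaklyDivFree (symRep b) := by
    intro θ hθ
    rw [← hbdiv θ hθ]
    exact integral_congr_ae (hbt_ae.mono fun x hx => by simp only [hx])
  -- the tree's swirl-free global Kato theorem, translated back to the axis through `ξ`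
  have hG : HasGlobalKatoSolution ν (symRep b) :=
    hasGlobalKatoSolution_of_isAxisymmetric_hasNoSwirl_viscosity hν hbt3 hbtdiv hrot hsw
  have hGa : HasGlobalKatoSolution ν (fun x => symRep b (x - ξ)) := hG.translate ξ
  have hat_ae : (fun x => symRep b (x - ξ)) =ᵐ[volume] a := by
    have h1 := (measurePreserving_sub_right volume ξ).quasiMeasurePreserving.ae_eq_comp hbt_ae
    refine h1.mono fun x hx => ?_
    simpa [Function.comp_def, hb] using hx
  -- port note (typer-1 g6): the kit's `AeAxisymmetricUpgrade.hasGlobalKatoSolution_congr_ae hGa hat_ae` (a module in the cone of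
  -- route file `Theses/AxisymmetricExtremality.lean`) is replaced by the route-independent tree lemma
  -- `HasGlobalKatoSolution.congr_datum_ae` (`Theorems/L3TimeExponentPincerNoSwirlKatoGlobal.lean`), same statement up to `symm`.
  exact hGa.congr_datum_ae hν hat_ae.symm

/-- **S3 PROVED (rev 4/5): swirl-free axisymmetric regularity in the `L³` local-Leray class.**  A local Leray
solution `U ∈ 𝒩(a)` from an a.e.-axisymmetric, a.e.-mirror-symmetric, weakly divergence-free `a ∈ L³` is
essentially bounded on a parabolic cylinder below every point `(t₀, x₀)`, `t₀ > 0`.  Proof: `a` has a global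
Kato solution (`hasGlobalKatoSolution_of_aeDihedral`: symmetrisation + the TREE's swirl-free global Kato
theorem); weak–strong uniqueness at viscosity `ν` (`leray_solution_ae_eq_kato_of_viscosity
leray_solution_ae_eq_kato_holds`, tree) identifies `U` with the Kato solution a.e. on `(0, t₀ + 1) × ℝ³`;
Kato smoothing (`kato_solution_le_div_sqrt_of_kato_local_L3 kato_local_L3_holds`, tree) bounds it by
`C/√t`, hence by `|C|/√(t₀/2)` on `Q_r(t₀, x₀)`, `r² = t₀/2`. -/
theorem noSwirlL3LerayRegular_holds : NoSwirlL3LerayRegular := by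
  intro ν hν ξ a U P _hξ ha hdiv hax hmir hU t₀ x₀ ht₀
  have hGa : HasGlobalKatoSolution ν a := hasGlobalKatoSolution_of_aeDihedral hν ha hdiv hax hmir
  -- Kato solution on `[0, t₀ + 1)`, weak–strong uniqueness, Kato smoothing
  obtain ⟨u, hu⟩ := hGa.exists_isKatoSolutionOn (t₀ + 1)
  have hae := leray_solution_ae_eq_kato_of_viscosity leray_solution_ae_eq_kato_holds hν _ ha hdiv
    U P hU (t₀ + 1) u hu
  obtain ⟨C, hC⟩ := kato_solution_le_div_sqrt_of_kato_local_L3 kato_local_L3_holds ν (t₀ + 1) _ u hν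
    hu (t₀ + 1 / 2) (by linarith) (by linarith)
  -- the cylinder `Q_r(t₀, x₀)`, `r² = t₀ / 2`
  have hsq : Real.sqrt (t₀ / 2) ^ 2 = t₀ / 2 := Real.sq_sqrt (by linarith)
  refine ⟨Real.sqrt (t₀ / 2), Real.sqrt_pos.2 (by linarith), ?_⟩
  set Q := parabolicCylinder (Real.sqrt (t₀ / 2)) ((t₀ : ℝ), x₀) with hQ
  have hmemQ : ∀ z ∈ Q, t₀ / 2 < z.1 ∧ z.1 < t₀ := by
    intro z hz
    have h := hz.1
    simp only [hsq] at h
    exact ⟨by linarith [h.1], h.2⟩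
  have hsub1 : Q ⊆ Ioo 0 (t₀ + 1) ×ˢ (univ : Set R3) := fun z hz =>
    ⟨⟨by linarith [(hmemQ z hz).1], by linarith [(hmemQ z hz).2]⟩, mem_univ _⟩
  have hsub2 : Q ⊆ Ioo 0 (t₀ + 1 / 2) ×ˢ (univ : Set R3) := fun z hz =>
    ⟨⟨by linarith [(hmemQ z hz).1], by linarith [(hmemQ z hz).2]⟩, mem_univ _⟩
  have h1 : ∀ᵐ z ∂(volume.restrict Q), uncurry U z = uncurry u z :=
    ae_restrict_of_ae_restrict_of_subset hsub1 hae
  have h2 : ∀ᵐ z ∂(volume.restrict Q), ‖u z.1 z.2‖ ≤ C / Real.sqrt z.1 :=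
    ae_restrict_of_ae_restrict_of_subset hsub2 hC
  have h3 : ∀ᵐ z ∂(volume.restrict Q), z ∈ Q :=
    ae_restrict_mem (measurableSet_parabolicCylinder _ _)
  have hpos : 0 < Real.sqrt (t₀ / 2) := Real.sqrt_pos.2 (by linarith)
  have hbound : ∀ᵐ z ∂(volume.restrict Q), ‖uncurry U z‖ ≤ |C| / Real.sqrt (t₀ / 2) := by
    filter_upwards [h1, h2, h3] with z hz1 hz2 hz3
    rw [hz1, uncurry]
    have hz := (hmemQ z hz3).1
    have hzpos : 0 < Real.sqrt z.1 := Real.sqrt_pos.2 (by linarith)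
    calc ‖u z.1 z.2‖ ≤ C / Real.sqrt z.1 := hz2
      _ ≤ |C| / Real.sqrt z.1 := by gcongr; exact le_abs_self C
      _ ≤ |C| / Real.sqrt (t₀ / 2) :=
          div_le_div_of_nonneg_left (abs_nonneg C) hpos (Real.sqrt_le_sqrt hz.le)
  rw [eLpNorm_exponent_top]
  exact eLpNormEssSup_lt_top_of_ae_bound hbound

/-- Name kept from rev ≤ 3 (was the `sorry`): S3 is now the theorem `noSwirlL3LerayRegular_holds`. -/
theorem stub_noSwirlL3LerayRegular : NoSwirlL3LerayRegular := noSwirlL3LerayRegular_holds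

/-! ## The theorem of the line -/

/-- **LINE 14: swirl-free `L³` regularity ⇒ the dihedral budgeted large-order cell.**  Kernel-checked
composition of S1ᴰ, the tree's weak-`L³` stability theorem with stability of singular points
(`leray_solution_L3_weak_stability_holds`, PROVED in the tree), S2ᴰ and the residual. -/
theorem row_F13dLargeL3_of (hR : NoSwirlL3LerayRegular) : Row_F13dLargeL3 := by
  intro ν K hν
  by_contra h
  push Not at h
  -- S1ᴰ: the normalised bad sequence
  obtain ⟨m, c, a, w, q, hm, hc, ha, hw, hsym, hmir, hsing⟩ := normalisedBadSequenceD (K := K) hν h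
  -- weak `L³` stability of local Leray solutions with stability of singular points (tree theorem)
  obtain ⟨σ, a', U, P, hσ, ha'3, ha'div, ha'le, hweak, hU, hstab, -⟩ :=
    leray_solution_L3_weak_stability_holds hν (K * ν).toNNReal a w q ha hw
  -- the limit solution is singular at `(1, 0)`
  have hUsing : ∀ r : ℝ, 0 < r →
      eLpNorm (uncurry U) ∞ (volume.restrict (parabolicCylinder r ((1 : ℝ), (0 : R3)))) = ∞ :=
    hstab 1 0 one_pos (fun k r hr => hsing (σ k) r hr)
  -- S2ᴰ: the weak limit is a.e.-axisymmetric and a.e.-mirror-symmetric about some vertical axis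
  obtain ⟨ξ, hξ, hax, hmx⟩ := profileRigidityD (M := (K * ν).toNNReal) (m := m ∘ σ) (c := c ∘ σ)
    (a := a ∘ σ) (f := a') (hm.comp hσ.tendsto_atTop) (fun j => hc (σ j))
    (fun j => ⟨(ha (σ j)).1, (ha (σ j)).2.2⟩) (fun j => hsym (σ j)) (fun j => hmir (σ j)) ha'3 hweak
  -- the residual: no singular point — contradiction
  obtain ⟨r, hr, hfin⟩ := hR ν hν ξ a' U P hξ ha'3 ha'div hax hmx hU 1 0 one_pos
  exact hfin.ne (hUsing r hr)

/-- **THE CELL IS A THEOREM (rev 4): `Row_F13dLargeL3` holds** — no hypothesis, no `sorry` in this file;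
S1ᴰ, S2ᴰ (with all its sub-lemmas) and S3 are PROVED above, S3 from the tree's swirl-free global Kato
theorem (standard axioms throughout; the tree theorems used BY NAME are listed in the module docstring).
**NOT THE ROW:** this concerns the SUB-CELL `Row_F13dLargeL3` (mirror clause AND critical budget
`‖u 0‖₃ ≤ K ν`, both absent from the row) only; the census row `Row_F13mLarge`, and `Row_F0`, `Row_F5`,
are untouched by this file and stay OPEN; no summit statement is proved by this line. -/
theorem row_F13dLargeL3_holds : Row_F13dLargeL3 :=
  row_F13dLargeL3_of noSwirlL3LerayRegular_holds

/-- Name kept from rev ≤ 3: the same theorem. -/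
theorem row_F13dLargeL3_of_stubs : Row_F13dLargeL3 := row_F13dLargeL3_holds

end Summit.NavierStokesRegularity.NavierStokesRegularity.Theorems.ScenarioCensus.RowF13dLargeL3

end
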